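import Summits.BirchSwinnertonDyer.BirchSwinnertonDyer.Theorems.EisensteinPrimesMazurMCOnCellBTwistbackLamOneRankOne
import Summits.BirchSwinnertonDyer.BirchSwinnertonDyer.Theorems.EisensteinPrimesMazurMCOnCellBTwistbackOnePartnerCertificates
import Literature.NumberTheory.EllipticCurves.PAdicBSDSplitMultiplicativeProofs
import Literature.NumberTheory.EllipticCurves.GlobalMinimalModelProofs
import HarnessLib

/-!
# Crux 3 `MazurMCOnCellB` (stmt-BirchSwinnertonDyer-19033), line `twistback` v4 — road (d′) at a SPLIT pair:
# `(μ_an, λ_an) = (0, 2)` (trivial zero included) gives the partner's analytic rank; stub 6 at a split X2b pair from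
# ONE admissible `K` + `(0, 2)` + the exceptional leading term at the twist — no analytic-rank input

Width seat bsd-line-x2-p1-w5 (g0), 2026-08-28; sequel of `…TwistbackLamOneRankOne` (p649897). HONEST FRAMING (cell
`bsd-eis`, run/shared/lean/pub/bsd-eis/): conditional theorems only. Named facts BY NAME: Wuthrich 2014 Thm. 16, the
parametrisation supply and modularity (conjuncts of the route's `PublishedInputs`, stmt-…-19037), Dokchitser–Dokchitser
2010 Thm. 1.4 (`selmerCorank_mod_two_eq`, PUB), Keller–Yin 2024 Thm. E multiplicative half
(`thmE_pConverse_semistable_OPEN`, UNREFEREED PREPRINT resting on Castella arXiv:2409.01360 — every theorem below that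
carries `hKY` is conditional on that OPEN claim; the line already carries Keller–Yin Thm. D, PRE). §3 moreover takes
the typed exceptional leading term `X2.O9.ExceptionalLeadingTermAt` per partner (`@[conjecture]` predicate, OPEN in
print for reducible `E[p]`; it is stub 5 of the skeleton at the partner). No `def`, no `sorry`; no main conjecture /
BSD proved for any curve unconditionally; 0 cells / labels / stubs / tiers move.

WHY. At a SPLIT X2b pair `(W, p)` every admissible partner `E^{(d_K)}` is split at `p` too (`p` splits in `K`), so
THE Mazur–Tate–Teitelbaum function has the trivial zero and the λ-minimal certificate reads `(μ_an, λ_an) = (0, 2)`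
(`X2.AnalyticLambdaEq` counts the trivial zero: `ι(T·g) = ϖ·L`, `λ(T·g) = 1 + λ(g)`). The squeeze of p649897 §1 still
gives `λ(g) = 1`, hence `corank_{ℤ_p} Sel_{p^∞}(E^K/ℚ) ≤ 1`, `= 1` by `p`-parity, and `r_an = 1` by Keller–Yin Thm. E
— so on the split half of the row (83/127 A10 cells are split) the per-partner door p640749 §3(iii)
`missingUpperBoundAt_of_cellC_of_split_of_lamMin_of_exceptionalLeadingTerm` no longer needs the partner's analytic
rank either; what it needs is `(0, 2)` and the exceptional leading term (OPEN).

* §1 `selmerCorank_le_one_of_analyticLambdaEq_two_split` — `p ≠ 2` SPLIT multiplicative, `E[p]` reducible,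
  `AnalyticMuLE W p 0 ∧ AnalyticLambdaEq W p 2` ⟹ `corank Sel_{p^∞}(E/ℚ) ≤ 1` (PUB inputs only).
* §2 `analyticRank_eq_one_of_analyticLambdaEq_two_of_odd_split` — + `r_an` odd + Dokchitser + Keller–Yin Thm. E ⟹
  `r_an = 1`.
* §3 `upperPartner_at_of_lamTwo_of_excLT_partner_of_thmE` — stub 6's clause at a SPLIT X2b pair `(W, p)` (VERBATIM
  shape) from ONE admissible `K` such that every minimal model of `E^{(d_K)}` has `(0, 2)` and
  `X2.O9.ExceptionalLeadingTermAt`.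

References: [Wuthrich2014] Thm. 16 (split clause: `T · char_Λ X ∣ ϖL`); [GreenbergLNM1716] §3 Lemma 3.1;
[MazurTateTeitelbaum1986Invent] §I.14, §II.10; [DokchitserDokchitserAnnals2010] Thm. 1.4; [KellerYin2024] Thm. E (PRE);
[SteinWuthrich2013] Thm. 6.1; [Disegni2020] Thm. 4(2) (hypothesis shape only).
-/

set_option autoImplicit false

-- `Summit.BirchSwinnertonDyer.BirchSwinnertonDyer.…`: the summit and its single sub-problem share a name.
set_option linter.dupNamespace false

noncomputable section

open scoped Classical MatrixGroups ModularForm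

open CongruenceSubgroup WeierstrassCurve NumberField IsDedekindDomain Field PowerSeries
  Literature.NumberTheory.EllipticCurves
  Literature.NumberTheory.GaloisRepresentations
  Literature.NumberTheory.EllipticCurves.ModularForms
  Literature.NumberTheory.QuadraticFields
  Literature.NumberTheory.EllipticCurves.Rank1Residual
  Literature.NumberTheory.EllipticCurves.Rank1Residual.Typed
  Literature.NumberTheory.EllipticCurves.Wuthrich2014
  Literature.NumberTheory.EllipticCurves.KellerYin2024
  Literature.NumberTheory.EllipticCurves.IwasawaAlgebra
  Summit.BirchSwinnertonDyer.Rank1Residual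
  Summit.BirchSwinnertonDyer.Rank1Residual.X2
  Summit.BirchSwinnertonDyer.Rank1Residual.X1.MuLambda
  Summit.BirchSwinnertonDyer.Rank1Residual.X1.RankOneParitySqueeze
  Summit.BirchSwinnertonDyer.BirchSwinnertonDyer.Theses
  Summit.BirchSwinnertonDyer.BirchSwinnertonDyer.Theorems.EisensteinPrimesMazurMCOnCellBTwistbackOnePartnerCertificates
  Summit.BirchSwinnertonDyer.BirchSwinnertonDyer.Theorems.EisensteinPrimesMazurMCOnCellBTwistbackLamOneRankOne

namespace Summit.BirchSwinnertonDyer.BirchSwinnertonDyer.Theorems.EisensteinPrimesMazurMCOnCellBTwistbackLamTwoRankOneSplit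

/-! ## §1. `(μ_an, λ_an) = (0, 2)` at a SPLIT multiplicative Eisenstein prime bounds the Selmer corank by `1` -/

/-- **`λ_an = 2` (trivial zero included) ⟹ `corank_{ℤ_p} Sel_{p^∞}(E/ℚ) ≤ 1` at a SPLIT multiplicative Eisenstein
prime `p ≠ 2`**, no rank input: Wuthrich Thm. 16 (split clause: `g ∈ char_Λ X` with `ι(T·g) = ϖ·L` for THE split
Mazur–Tate–Teitelbaum function, `exists_isSplitMultPAdicLFunctionOf`), `λ(T·g) = 1 + λ(g) = 2` (`lam_mul`, `lam_X`), and
the squeeze `corank Sel ≤ rank X/TX ≤ ord_{T=0} g ≤ λ(g) = 1` (`selmerCorank_le_coinvariantsRank`,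
`coinvariantsRank_le_order_of_mem_charIdeal`, `order_le_lam`). PUB inputs only.
[cite: Wuthrich2014, Thm. 16 (p. 397)] [cite: GreenbergLNM1716, §3 Lemma 3.1] [cite: MazurTateTeitelbaum1986Invent, §I.14] -/
theorem selmerCorank_le_one_of_analyticLambdaEq_two_split (hWu : thm16_charIdeal_dvd_multiplicative_of_reducible)
    (hpar : nonempty_modularParametrizationData)
    (W : WeierstrassCurve ℚ) [W.IsElliptic] [W.IsGloballyMinimal] (p : ℕ) [Fact p.Prime]
    (hp2 : p ≠ 2) (hsplit : W.HasSplitMultiplicativeReductionAtPrime p) (hred : ¬ W.HasIrreducibleModPGaloisRep p)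
    (hμ0 : AnalyticMuLE W p 0) (hlam : AnalyticLambdaEq W p 2) :
    W.selmerCorank p ≤ 1 := by
  have hmult : W.HasMultiplicativeReductionAtPrime p := hsplit.1
  obtain ⟨κ, hκ, γ, hγ, hγ'⟩ := exists_isCyclotomic_isTopGenerator_isCyclotomicVariable_holds p
  obtain ⟨D⟩ := W.nonempty_selmerDualData_holds κ γ hγ
  haveI : NeZero (W.conductorNorm ℤ) := ⟨(W.conductorNorm_pos_holds).ne'⟩
  obtain ⟨Dm⟩ := hpar W
  obtain ⟨ϖ, -, hϖ, -⟩ := Dm.exists_rat_mul_realPeriodRat_eq_plusPeriod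
  obtain ⟨L, hL⟩ := exists_isSplitMultPAdicLFunctionOf hsplit Dm.isNewformOf
  haveI : Module.Finite (IwasawaAlgebra p) D.X := D.module_finite_holds hγ
  -- Wuthrich Thm. 16, split clause: `X` torsion, `g ∈ char X` with `ι(T·g) = ϖ·L`
  obtain ⟨hX, -, hKs⟩ := hWu W p hp2 hmult hred hκ hγ hγ' Dm.isNewformOf D ϖ hϖ
  obtain ⟨g, hg, hιg⟩ := hKs hsplit L hL
  -- `λ(T·g) = 2`, `T·g ≠ 0`, hence `λ(g) = 1`
  have hlamXg : lam ((PowerSeries.X : IwasawaAlgebra p) * g) = 2 :=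
    hlam Dm.f Dm.isNewformOf ϖ hϖ L (fun _ ↦ hL) (fun hns ↦ absurd hsplit hns) _ hιg
  obtain ⟨k, hk⟩ := hμ0 Dm.f Dm.isNewformOf ϖ hϖ L (fun _ ↦ hL) (fun hns ↦ absurd hsplit hns)
  have hL0 : PowerSeries.C ((ϖ : ℚ) : ℚ_[p]) * L ≠ 0 := ne_zero_of_lt_norm_coeff hk
  have hg0 : g ≠ 0 := by
    rintro rfl
    exact hL0 (by rw [← hιg, mul_zero, map_zero])
  have hX0 : (PowerSeries.X : IwasawaAlgebra p) ≠ 0 := PowerSeries.X_ne_zero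
  have hlamg : lam g = 1 := by
    rw [lam_mul hX0 hg0, lam_X] at hlamXg
    omega
  -- the squeeze
  have h1 : W.selmerCorank p ≤ coinvariantsRank p D.X := W.selmerCorank_le_coinvariantsRank hγ D
  have h2 : (coinvariantsRank p D.X : ℕ∞) ≤ g.order :=
    coinvariantsRank_le_order_of_mem_charIdeal D.X hX g hg
  have h3 : g.order ≤ ((lam g : ℕ) : ℕ∞) := order_le_lam hg0
  have h4 : (coinvariantsRank p D.X : ℕ∞) ≤ ((1 : ℕ) : ℕ∞) := by
    rw [← hlamg]; exact h2.trans h3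
  have h5 : coinvariantsRank p D.X ≤ 1 := by exact_mod_cast h4
  exact h1.trans h5

/-! ## §2. `(0, 2)` ∧ `r_an` odd ⟹ `ord_{s=1} L(E, s) = 1` at a SPLIT multiplicative Eisenstein prime -/

/-- **Road (d′) at a split prime, core**: `(μ_an, λ_an) = (0, 2)` + odd analytic rank ⟹ `ord_{s=1} L(E, s) = 1` at a
SPLIT multiplicative Eisenstein prime `p ≠ 2` — §1 + `p`-parity (`hDD`, Dokchitser–Dokchitser Thm. 1.4) + Keller–Yin
Thm. E multiplicative half (`hKY`, PRE). [claim: KellerYin2024, status: under-review]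
[cite: DokchitserDokchitserAnnals2010, Thm. 1.4] [cite: Wuthrich2014, Thm. 16 (p. 397)] -/
theorem analyticRank_eq_one_of_analyticLambdaEq_two_of_odd_split
    (hWu : thm16_charIdeal_dvd_multiplicative_of_reducible) (hpar : nonempty_modularParametrizationData)
    (hKY : thmE_pConverse_semistable_OPEN)
    (W : WeierstrassCurve ℚ) [W.IsElliptic] [W.IsGloballyMinimal] (p : ℕ) [Fact p.Prime]
    (hDD : selmerCorank_mod_two_eq W p)
    (hp2 : p ≠ 2) (hsplit : W.HasSplitMultiplicativeReductionAtPrime p) (hred : ¬ W.HasIrreducibleModPGaloisRep p)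
    (hodd : Odd W.analyticRank) (hμ0 : AnalyticMuLE W p 0) (hlam : AnalyticLambdaEq W p 2) :
    W.analyticRank = 1 := by
  have hpP : p.Prime := Fact.out
  have hp : 2 < p := lt_of_le_of_ne hpP.two_le (Ne.symm hp2)
  have hle := selmerCorank_le_one_of_analyticLambdaEq_two_split hWu hpar W p hp2 hsplit hred hμ0 hlam
  have hmod : W.selmerCorank p % 2 = W.analyticRank % 2 := hDD
  have hcork : W.selmerCorank p = 1 := by
    rcases hodd with ⟨k, hk⟩
    omega
  exact hKY W p hp (Or.inr hsplit.1) hred 1 (Or.inr rfl) hcork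

/-! ## §3. Stub 6 at a SPLIT X2b pair from ONE admissible `K` + `(0, 2)` + the exceptional leading term at the twist -/

/-- **Stub 6's conclusion AT ONE SPLIT X2b pair (VERBATIM shape), the partner's analytic rank DERIVED**: for a SPLIT
X2b pair `(W, p)` (`ord_{s=1} L(E, s) = 0`, `p ≠ 2` split multiplicative, `E[p]` reducible) and ONE admissible `K`
(imaginary quadratic, Heegner for `N_W` and for `p`, `d_K` odd `< −4`) such that every globally minimal model `Wd` of
`E^{(d_K)}` carries the census certificate `(μ_an, λ_an)(Wd, p) = (0, 2)` and the typed exceptional leading term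
`X2.O9.ExceptionalLeadingTermAt Wd p` (OPEN in print; stub 5 at the partner): the partner clause of `stub_upperPartner`
holds at `(W, p)` with this `K`. The twist is split at `p` (`p` splits in `K`), X2 (`X2.classX2_twist`), of odd
analytic rank (`r_an(E) = 0`, Heegner sign; p649897 §2), so §2 gives `r_an(Wd) = 1` (a minimal model exists,
`hasGlobalMinimalModel_rat_holds`), and p640749 §3(iii)
`missingUpperBoundAt_of_cellC_of_split_of_lamMin_of_exceptionalLeadingTerm` gives the upper half at every minimal
model. Inputs BY NAME: `PublishedInputs`, Dokchitser (PUB); Keller–Yin Thm. E (PRE); per partner `(0,2)` + excLT.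
[claim: KellerYin2024, status: under-review] [cite: MazurTateTeitelbaum1986Invent, §II.10 (hypothesis)]
[cite: SteinWuthrich2013, Thm. 6.1 (p. 20), §4.2] [cite: Wuthrich2014, Thm. 16 (p. 397)] [cite: DokchitserDokchitserAnnals2010, Thm. 1.4]
[cite: SilvermanAEC2009, VIII.8 Cor. 8.3] -/
theorem upperPartner_at_of_lamTwo_of_excLT_partner_of_thmE (hP : EisensteinPrimes.PublishedInputs)
    (hDD : ∀ (V : WeierstrassCurve ℚ) [V.IsElliptic] (ℓ : ℕ) [Fact ℓ.Prime], selmerCorank_mod_two_eq V ℓ)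
    (hKY : thmE_pConverse_semistable_OPEN)
    (W : WeierstrassCurve ℚ) [W.IsElliptic] [W.IsGloballyMinimal] (p : ℕ) [Fact p.Prime]
    (hc : X2.CellB W p) (hsplit : W.HasSplitMultiplicativeReductionAtPrime p)
    (K : Type) [Field K] [NumberField K] (hK : IsImaginaryQuadratic K)
    (hHN : SatisfiesHeegnerHypothesis (W.conductorNorm ℤ) K) (hHp : SatisfiesHeegnerHypothesis p K)
    (hodd : Odd (NumberField.discr K)) (hlt : NumberField.discr K < -4)
    (hcert : ∀ (Wd : WeierstrassCurve ℚ) [Wd.IsElliptic] [Wd.IsGloballyMinimal],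
      (∃ C : VariableChange ℚ, C • Wd = W.quadraticTwist (NumberField.discr K : ℚ)) →
      X2.AnalyticMuLE Wd p 0 ∧ X2.AnalyticLambdaEq Wd p 2 ∧ X2.O9.ExceptionalLeadingTermAt Wd p) :
    ∃ (K : Type) (_ : Field K) (_ : NumberField K), IsImaginaryQuadratic K ∧
      SatisfiesHeegnerHypothesis (W.conductorNorm ℤ) K ∧ SatisfiesHeegnerHypothesis p K ∧
      Odd (NumberField.discr K) ∧ NumberField.discr K < -4 ∧
      (W.quadraticTwist (NumberField.discr K : ℚ)).analyticRank = 1 ∧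
      ∀ (Wd : WeierstrassCurve ℚ) [Wd.IsElliptic] [Wd.IsGloballyMinimal],
        (∃ C : VariableChange ℚ, C • Wd = W.quadraticTwist (NumberField.discr K : ℚ)) →
        MissingUpperBoundAt Wd p := by
  have hpar := hP.2.2.2.2.1
  have hnf := hP.2.2.2.2.2.1
  have hWu := hP.2.2.2.2.2.2.2.2.2.2.2.2.2.2.1
  have hp2 : p ≠ 2 := hc.2.1.1
  have hmult : W.HasMultiplicativeReductionAtPrime p := hc.2.1.2.2
  have hr0 : W.analyticRank = 0 := hc.1
  have hdK : (NumberField.discr K : ℚ) ≠ 0 := by exact_mod_cast NumberField.discr_ne_zero K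
  haveI := W.isElliptic_quadraticTwist hdK
  -- every minimal model of the twist is split X2 of odd analytic rank, hence of analytic rank `1`
  have hmodel : ∀ (Wd : WeierstrassCurve ℚ) [Wd.IsElliptic] [Wd.IsGloballyMinimal],
      (∃ C : VariableChange ℚ, C • Wd = W.quadraticTwist (NumberField.discr K : ℚ)) →
      Wd.analyticRank = (W.quadraticTwist (NumberField.discr K : ℚ)).analyticRank ∧ Wd.analyticRank = 1 := by
    intro Wd _ _ hWd
    obtain ⟨C, hC⟩ := hWd
    have hXd : ClassX2 Wd p := X2.classX2_twist W p hc.2.1 K hK hHp Wd ⟨C, hC⟩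
    have hsd : Wd.HasSplitMultiplicativeReductionAtPrime p :=
      (X2.hasSplitMultiplicativeReductionAtPrime_iff_of_smul_eq_quadraticTwist W Wd hK p hp2 hmult hHp hC).mpr
        hsplit
    have hrd : Wd.analyticRank = (W.quadraticTwist (NumberField.discr K : ℚ)).analyticRank := by
      have h := congrArg WeierstrassCurve.analyticRank hC
      rwa [analyticRank_smul] at h
    have hoddd : Odd Wd.analyticRank := by
      rw [hrd]
      exact EisensteinPrimesMazurMCOnCellBTwistbackLamOneRankOne.odd_analyticRank_quadraticTwist_of_analyticRank_eq_zero
        hnf W hr0 K hK hHN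
    obtain ⟨hμ, hlam, -⟩ := hcert Wd ⟨C, hC⟩
    exact ⟨hrd, analyticRank_eq_one_of_analyticLambdaEq_two_of_odd_split hWu hpar hKY Wd p (hDD Wd p) hp2 hsd
      hXd.2.1 hoddd hμ hlam⟩
  -- the twist has analytic rank `1` (read on any minimal model)
  obtain ⟨C₀, hC₀⟩ := hasGlobalMinimalModel_rat_holds (W.quadraticTwist (NumberField.discr K : ℚ))
  have hr1 : (W.quadraticTwist (NumberField.discr K : ℚ)).analyticRank = 1 := by
    haveI : (C₀ • W.quadraticTwist (NumberField.discr K : ℚ)).IsGloballyMinimal := hC₀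
    obtain ⟨hrd, h1⟩ := hmodel (C₀ • W.quadraticTwist (NumberField.discr K : ℚ)) ⟨C₀⁻¹, inv_smul_smul C₀ _⟩
    rw [← hrd, h1]
  refine ⟨K, inferInstance, inferInstance, hK, hHN, hHp, hodd, hlt, hr1, fun Wd _ _ hWd ↦ ?_⟩
  obtain ⟨hrd, h1⟩ := hmodel Wd hWd
  obtain ⟨C, hC⟩ := hWd
  have hXd : ClassX2 Wd p := X2.classX2_twist W p hc.2.1 K hK hHp Wd ⟨C, hC⟩
  have hsd : Wd.HasSplitMultiplicativeReductionAtPrime p :=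
    (X2.hasSplitMultiplicativeReductionAtPrime_iff_of_smul_eq_quadraticTwist W Wd hK p hp2 hmult hHp hC).mpr
      hsplit
  obtain ⟨hμ, hlam, hExc⟩ := hcert Wd ⟨C, hC⟩
  exact EisensteinPrimesMazurMCOnCellBTwistbackOnePartnerCertificates.missingUpperBoundAt_of_cellC_of_split_of_lamMin_of_exceptionalLeadingTerm
    hP Wd p ⟨h1, hXd⟩ hsd hμ hlam hExc

end Summit.BirchSwinnertonDyer.BirchSwinnertonDyer.Theorems.EisensteinPrimesMazurMCOnCellBTwistbackLamTwoRankOneSplit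

end
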